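import Summits.HubbardSuperconductivity.HubbardSuperconductivity.Theorems.AnisotropyChordInsertionEntropyUniformDensity

/-!
# Route `AnisotropyChord` / H0 rotor rung, route (1) «ODLRO transfer across sectors»: (H4) TRANSLATION INVARIANCE of
# Perron sector ground amplitudes (port + proof of theory seat `hubbard-h0-rotor-theory-1`'s `PerronTranslationInvariant`,
# cycle 12 `PartE.lean`, memo ROTOR-THEORY-11 §175; landing plan item 2 of THEOREM-T.md)

`shiftCfg` and `PerronTranslationInvariant Δ` VERBATIM from PartE.lean; the proof is the tree's
`InsertionEntropy.perronAmplitude_comp_iso` (Perron uniqueness + automorphism invariance of `H(Δ)`) applied to the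
translation automorphism `torusTranslationIso L v`.  Holds for every `Δ` (no sign condition).
-/

set_option linter.dupNamespace false
set_option autoImplicit false

noncomputable section

open Finset Filter Topology
open Literature.MathematicalPhysics.QuantumLattice Literature.Probability.LatticeModels
open Summit.HubbardSuperconductivity.HubbardSuperconductivity.Theorems.AnisotropyChord.InsertionEntropy

namespace Summit.HubbardSuperconductivity.HubbardSuperconductivity.Theorems.AnisotropyChord.Transfer

variable (L : ℕ) [NeZero L]

/-- configuration translated by `v` (VERBATIM port of the theory seat's `shiftCfg`, PartE.lean). [folklore] -/
def shiftCfg (v : TorusSite 2 L) (σ : TensorIndex (TorusSite 2 L) 2) : TensorIndex (TorusSite 2 L) 2 :=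
  fun s => σ (s + v)

/-- **(H4) Perron sector ground amplitudes are translation invariant** (VERBATIM port of the theory seat's
`PerronTranslationInvariant`, PartE.lean: provable by uniqueness of the Perron vector + translation invariance of `H(Δ)`).
[conjecture: support statement, provable; memo §175 — Lean proof below] -/
def PerronTranslationInvariant (Δ : ℝ) : Prop :=
  ∀ (L : ℕ) [NeZero L] (M : ℝ) (a : TensorIndex (TorusSite 2 L) 2 → ℝ),
    IsPerronSectorGroundAmplitude L Δ M a → ∀ v σ, a (shiftCfg L v σ) = a σ

variable {L}

omit [NeZero L] in
/-- `shiftCfg v σ = σ ∘ (translation by v)`. [folklore] -/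
theorem shiftCfg_eq_comp (v : TorusSite 2 L) (σ : TensorIndex (TorusSite 2 L) 2) :
    shiftCfg L v σ = σ ∘ (torusTranslationIso L v) := by
  funext s; rfl

/-- **(H4) HOLDS for every anisotropy `Δ`.** [conjecture: theory seat hubbard-h0-rotor-theory-1, cycle 12 — (H4); Lean proof here] -/
theorem perronTranslationInvariant_holds (Δ : ℝ) : PerronTranslationInvariant Δ := by
  intro L _ M a ha v σ
  rw [shiftCfg_eq_comp]
  exact perronAmplitude_comp_iso L Δ M a ha (torusTranslationIso L v) σ

end Summit.HubbardSuperconductivity.HubbardSuperconductivity.Theorems.AnisotropyChord.Transfer
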